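import Mathlib.Analysis.SpecialFunctions.OrdinaryHypergeometric
import Mathlib.Analysis.Analytic.ChangeOrigin
import Mathlib.Analysis.SpecialFunctions.Complex.Analytic
import Mathlib.Analysis.SpecialFunctions.Pow.Real
import Mathlib.Analysis.SpecialFunctions.Gamma.Basic
import HarnessLib

-- provenance: harness21/H21/H21/Statements/CritPerc/Wave0.lean @ fddaeb8 (interim HEAD d8f2665); M5 mechanical rewrite
/-!
# Critical percolation on `ℤ²` (family `crit-perc`), wave 0

This file records the wave-0 target statements of the `crit-perc` family (critical bond
percolation on `ℤ²`, Cardy's formula, convergence to `SLE₆`) that are statable against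
Mathlib today.

## Covered statement ids

* **crit-perc.S18** (definition role): the Gauss hypergeometric series
  `₂F₁(a,b;c;z) = Σ (a)ₙ(b)ₙ/((c)ₙ n!) zⁿ` has radius of convergence `1` when no parameter is a
  non-positive integer; consequently Cardy's function
  `F(η) = (3Γ(2/3)/Γ(1/3)²) η^{1/3} ₂F₁(1/3, 2/3; 4/3; η)` is real-analytic on `(0,1)`.
  Mathlib already provides the series (`ordinaryHypergeometricSeries`), its sum
  (`ordinaryHypergeometric`, notation `₂F₁`) and the radius theorem itself
  (`ordinaryHypergeometricSeries_radius_eq_one`), which we USE rather than restate. New here: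
  the power-series representation / analyticity of `₂F₁ a b c` on the open unit ball, the
  specialisation to Cardy's parameters `(1/3, 2/3; 4/3)` over `ℝ`, and real-analyticity of
  Cardy's function `cardyFunction` on `Set.Ioo 0 1`.

## Skipped statement ids

* `crit-perc.S01`–`S17`, `S19`–`S27`: marked `statable_today: false` in the gap inventory
  (they need Bernoulli percolation measures on `ℤ²`, domain discretisation, crossing events,
  conformal rectangles / Riemann mapping with boundary extension, `SLE_κ`, or Gauss's summation
  formula for `₂F₁` at `z = 1`, none of which are in Mathlib or the H21 prelude yet).

## Design notes

* The closed-form expression `cardyFunction` (the right-hand side of Cardy's formula) is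
  defined here only because S18's parenthetical is about it; its characteristic properties
  (`F(0) = 0`, `F(1) = 1`, `F(η) + F(1-η) = 1`, inventory item S17) need Gauss's summation theorem
  and are not stated in this wave. When a `Literature.Prelude` module for `crit-perc` is created, this
  definition should move there unchanged.
* All proofs in this file are complete (no `sorry`).

## References

* C. F. Gauss, *Disquisitiones generales circa seriem infinitam* (1812).
* J. Cardy, *Critical percolation in finite geometries*, J. Phys. A 25 (1992) L201.
* summits/crit-perc-z2/SUMMIT.md.
-/

namespace Literature.Probability.Percolation

section General

variable {𝕂 : Type*} {𝔸 : Type*} [RCLike 𝕂] [NormedDivisionRing 𝔸] [NormedAlgebra 𝕂 𝔸]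
  [CompleteSpace 𝔸] (a b c : 𝕂)

/-- **crit-perc.S18** (radius of convergence of the Gauss hypergeometric series and the
resulting power-series representation; Gauss 1812; the radius statement is Mathlib's
`ordinaryHypergeometricSeries_radius_eq_one`).
If none of `a`, `b`, `c` is a non-positive integer, the Gauss hypergeometric series
`₂F₁(a,b;c;z) = Σₙ (a)ₙ (b)ₙ / ((c)ₙ n!) zⁿ` has radius of convergence exactly `1`, so
`z ↦ ₂F₁(a,b;c;z)` is given by this power series on the open unit ball. [cite: Gauss1812] -/
theorem ordinaryHypergeometric_hasFPowerSeriesOnBall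
    (habc : ∀ k : ℕ, (k : 𝕂) ≠ -a ∧ (k : 𝕂) ≠ -b ∧ (k : 𝕂) ≠ -c) :
    HasFPowerSeriesOnBall (₂F₁ a b c : 𝔸 → 𝔸) (ordinaryHypergeometricSeries 𝔸 a b c) 0 1 := by
  have h := (ordinaryHypergeometricSeries 𝔸 a b c).hasFPowerSeriesOnBall
    (by rw [ordinaryHypergeometricSeries_radius_eq_one 𝔸 a b c habc]; exact one_pos)
  rwa [ordinaryHypergeometricSeries_radius_eq_one 𝔸 a b c habc] at h

/-- **crit-perc.S18** (analyticity of `₂F₁` on the open unit ball; Gauss 1812).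
If none of `a`, `b`, `c` is a non-positive integer, `z ↦ ₂F₁(a,b;c;z)` is analytic on the open
unit ball `‖z‖ < 1`. [cite: Gauss1812] -/
theorem analyticOnNhd_ordinaryHypergeometric
    (habc : ∀ k : ℕ, (k : 𝕂) ≠ -a ∧ (k : 𝕂) ≠ -b ∧ (k : 𝕂) ≠ -c) :
    AnalyticOnNhd 𝕂 (₂F₁ a b c : 𝔸 → 𝔸) (Metric.eball 0 1) :=
  (ordinaryHypergeometric_hasFPowerSeriesOnBall a b c habc).analyticOnNhd

end General

section Cardy

/-- The parameters `(1/3, 2/3; 4/3)` of the hypergeometric factor in Cardy's formula are not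
non-positive integers (elementary; needed to apply
`ordinaryHypergeometricSeries_radius_eq_one`; Cardy 1992). [cite: Cardy1992] -/
theorem cardy_params_ne_neg_nat (k : ℕ) :
    (k : ℝ) ≠ -(1 / 3 : ℝ) ∧ (k : ℝ) ≠ -(2 / 3 : ℝ) ∧ (k : ℝ) ≠ -(4 / 3 : ℝ) := by
  have hk : (0 : ℝ) ≤ k := k.cast_nonneg
  refine ⟨?_, ?_, ?_⟩ <;> intro h <;> linarith

/-- **crit-perc.S18** (Cardy's hypergeometric factor; Cardy 1992, Gauss 1812).
The real power series `₂F₁(1/3, 2/3; 4/3; η)` appearing in Cardy's crossing formula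
`F(η) = (3Γ(2/3)/Γ(1/3)²) η^{1/3} ₂F₁(1/3, 2/3; 4/3; η)` has radius of convergence `1`. [cite: Cardy1992, Gauss 1812] -/
theorem ordinaryHypergeometricSeries_cardy_radius_eq_one :
    (ordinaryHypergeometricSeries ℝ (1 / 3 : ℝ) (2 / 3) (4 / 3)).radius = 1 :=
  ordinaryHypergeometricSeries_radius_eq_one ℝ _ _ _ cardy_params_ne_neg_nat

/-- **crit-perc.S18** (real-analyticity of Cardy's hypergeometric factor on `(0,1)`;
Cardy 1992, Gauss 1812; summits/crit-perc-z2/SUMMIT.md).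
The function `η ↦ ₂F₁(1/3, 2/3; 4/3; η)` is real-analytic on the open interval `(0,1)`. [cite: Cardy1992, Gauss 1812] -/
theorem analyticOnNhd_cardy_hypergeometric_Ioo :
    AnalyticOnNhd ℝ (₂F₁ (1 / 3 : ℝ) (2 / 3 : ℝ) (4 / 3 : ℝ) : ℝ → ℝ) (Set.Ioo 0 1) := by
  refine (analyticOnNhd_ordinaryHypergeometric (𝔸 := ℝ) (1 / 3 : ℝ) (2 / 3) (4 / 3)
    cardy_params_ne_neg_nat).mono ?_
  intro x hx
  rw [Metric.mem_eball, edist_zero_right, ← ofReal_norm, Real.norm_eq_abs,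
    ENNReal.ofReal_lt_one]
  exact abs_lt.2 ⟨by linarith [hx.1], hx.2⟩

/-- Cardy's function, the right-hand side of Cardy's crossing formula (Cardy 1992, eq. (11);
summits/crit-perc-z2/SUMMIT.md):
`F(η) = (3 Γ(2/3) / Γ(1/3)²) · η^{1/3} · ₂F₁(1/3, 2/3; 4/3; η)` for a real cross-ratio `η`.
It is intended to be used for `η ∈ [0,1]`; outside `[0,1)` the value is whatever Mathlib's
`Real.rpow` and the (possibly divergent, hence junk-valued) series sum give. [cite: Cardy1992, eq. (11] -/
noncomputable def cardyFunction (η : ℝ) : ℝ :=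
  3 * Real.Gamma (2 / 3) / Real.Gamma (1 / 3) ^ 2 * η ^ (1 / 3 : ℝ) *
    ₂F₁ (1 / 3 : ℝ) (2 / 3 : ℝ) (4 / 3 : ℝ) η

/-- The real cube root `η ↦ η^{1/3}` (as `Real.rpow`) is real-analytic on `(0, ∞)`
(elementary: `η^{1/3} = exp (log η / 3)` there). [folklore] -/
theorem analyticOnNhd_rpow_one_third_Ioi :
    AnalyticOnNhd ℝ (fun η : ℝ => η ^ (1 / 3 : ℝ)) (Set.Ioi 0) := by
  intro x hx
  have h : (fun η : ℝ => Real.exp (Real.log η * (1 / 3 : ℝ))) =ᶠ[nhds x]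
      fun η : ℝ => η ^ (1 / 3 : ℝ) := by
    filter_upwards [isOpen_Ioi.mem_nhds hx] with η hη
    exact (Real.rpow_def_of_pos hη _).symm
  refine AnalyticAt.congr ?_ h
  exact ((analyticAt_log hx).mul analyticAt_const).rexp

/-- **crit-perc.S18** (real-analyticity of Cardy's function on `(0,1)`; Cardy 1992,
Gauss 1812; summits/crit-perc-z2/SUMMIT.md).
Since `₂F₁(1/3, 2/3; 4/3; ·)` has radius of convergence `1` and `η^{1/3}` is real-analytic for
`η > 0`, Cardy's function `F` is real-analytic on the open interval `(0,1)`. [cite: Cardy1992, Gauss 1812] -/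
theorem analyticOnNhd_cardyFunction_Ioo : AnalyticOnNhd ℝ cardyFunction (Set.Ioo 0 1) := by
  intro x hx
  have h1 : AnalyticAt ℝ (fun η : ℝ => η ^ (1 / 3 : ℝ)) x :=
    analyticOnNhd_rpow_one_third_Ioi x hx.1
  have h2 : AnalyticAt ℝ (₂F₁ (1 / 3 : ℝ) (2 / 3 : ℝ) (4 / 3 : ℝ) : ℝ → ℝ) x :=
    analyticOnNhd_cardy_hypergeometric_Ioo x hx
  exact (analyticAt_const.mul h1).mul h2

end Cardy

end Literature.Probability.Percolation
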